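import Mathlib
import Summits.ValiantsHypothesis.ValiantsHypothesis.Theorems.FifoMatchingNNDivisionHardNewtonDimensionSteps
import HarnessLib

/-!
# Route FifoMatching — crux `NNDivisionHard` (stmt-ValiantsHypothesis-21181): the NEWTON-DIMENSION DESCENT, file 2 of 2 —
# cofactors whose Newton polytope has dimension `≤ √n − 1` are not certificates

All genericity rungs of the tree (`…ArcElimination`, `…FewArcFaces`, `…ManyArcFaces`, `…PowerSums`, …) test ONE direction
`𝟙_{I^c}`: if the outer `I`-face `top_{𝟙_{I^c}} h` of the cofactor is a single monomial, the certificate computes the hard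
face `NN_n^{¬I}`.  This file iterates the test ARC BY ARC and lets the cofactor choose the arcs.  Start from the total-degree
initial form `g₀ = top_𝟙 h` (free, `NN_n` is homogeneous).  While the current initial form `g` has two monomials, pick an arc
`e` on which two monomials of `g` differ and pass to the direction `𝟙_{≠ e}` (free and multiplicative over `ℝ≥0`):

* on the matching side the arc-avoiding face `NN_n^{¬I}` becomes `NN_n^{¬(I ∪ {e})}` if some member avoids `e` and stays
  `NN_n^{¬I}` otherwise (`…NewtonDimensionSteps.topComponent_face_insert/_self`) — ALWAYS an arc-avoiding face, with at most
  one more avoided arc;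
* on the cofactor side the new initial form is pinned at `e` (`…Steps.apply_eq_of_mem_support_topComponent`), so the
  dimension of the affine span of its support — the dimension of its NEWTON POLYTOPE — drops by at least one
  (`…Steps.finrank_vectorSpan_lt_of_pinned`).

Hence (★★ `descent`, `exists_face_of_newtonDim`) after at most `dim Newt(h)` free steps the cofactor is a single monomial
and the certificate computes `NN_n^{¬I} · c x^d` with `|I| ≤ dim Newt(h)`; Jukna–Seiwert–Sergeev stripping
(`complexity_face_le_of_newtonDim`) and the halving recursion `…ManyArcFaces.sqrtArcFaces_qp_hard` give

* ★★ `newtonDim_not_certificate_qp` — **for every `c`, eventually in `n`: every `h ≠ 0` with `(dim Newt(h) + 1)² ≤ n`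
  satisfies `2^((log₂ n + c)^c) < L₊(NN_n · h) + L₊(h)`** (`dim Newt(h)` is spelled
  `finrank ℚ (vectorSpan ℚ {(u : arcs → ℚ) : u ∈ supp h})`);
* ★ `newtonDim_top_not_certificate_qp` — the same after any free initial form `h ↦ top_w h` with `top_w NN_n = NN_n` (vertex
  potentials: the tier applies to the torus-homogeneous initial forms of a cofactor);
* ★ `fewMonomials_not_certificate_qp` — cofactors with `|supp h|² ≤ n` (at most `√n` monomials, of ANY degrees and supports)
  are not certificates;
* ★ `lowRank_not_certificate_qp` — cofactors all of whose monomials lie on a translated lattice `u₀ + ℕ v₁ + ⋯ + ℕ v_D`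
  with `(D + 1)² ≤ n` — i.e. `h = x^{u₀} · G(x^{v₁}, …, x^{v_D})` for ANY polynomial `G` in `D ≤ √n − 1` ARBITRARY
  monomials (the power sums / binomial powers of `…PowerSums`, `…BinomialPowers`, `…ArcFaces`, `…ManyArcFaces` are the case
  `G = (Σ cₖ yₖ)^N`, `vₖ` perfect matchings) — are not certificates;
* ★ BY NAME `nnDivisionHard_iff_highNewtonDimTier` — **`Theses.FifoMatching.NNDivisionHard` ⟺ its tier of cofactors of
  HIGH NEWTON DIMENSION `n < (dim Newt(h) + 1)²`.**

HONEST FRAMING: a rung (one free descent engine + one tier) toward ONE crux; certificates must have Newton polytopes of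
dimension `≥ √n`, nothing is said about those; stmt-21181 stays OPEN; nothing here bears on `NNNotVP` or on VP ≠ VNP (NOT
proved).  No definitions, no named facts.
References: Hrubeš–Yehudayoff 2021 §6 Problem 2 [HrubesYehudayoff2021]; Bürgisser 2000 Rem. 2.7 [Burgisser2000];
Jukna–Seiwert–Sergeev 2022 Thm 1 [JuknaSeiwertSergeev2022].
-/

noncomputable section

-- Sub = Summit single-conjunct layout: the duplicated namespace component is mandated by the tree.
set_option linter.dupNamespace false
set_option autoImplicit false

namespace Summit.ValiantsHypothesis.ValiantsHypothesis.Theorems.FifoMatching.NNDivisionHard.NewtonDimension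

open Finset MvPolynomial Literature.Computability.AlgebraicComplexity
open Summit.ValiantsHypothesis.ValiantsHypothesis.Theorems.ZeroOneTransfer.Negative
  (topComponent topComponent_mul complexity_topComponent_le topComponent_ne_zero support_topComponent_subset
    topComponent_eq_self_of_isWeightedHomogeneous)
open Summit.ValiantsHypothesis.ValiantsHypothesis.Theorems.FifoMatching.NNDivisionHard.FewArcsAvoidable
  (exists_nestFree_avoiding_of_card_le)
open Summit.ValiantsHypothesis.ValiantsHypothesis.Theorems.FifoMatching.NNDivisionHard.ManyArcFaces
  (sqrtArcFaces_qp_hard)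
open Summit.ValiantsHypothesis.ValiantsHypothesis.Theorems.DivisionGap.PerCofactorDegreeReduction.MonomialStripping
  (complexity_le_of_monomial_mul)
open Summit.ValiantsHypothesis.ValiantsHypothesis.Theorems.FifoMatching.NNDivisionHard.NewtonDimensionSteps
  (finrank_vectorSpan_lt_of_pinned finrank_vectorSpan_pos finrank_vectorSpan_image_le_card_pred
    finrank_vectorSpan_image_le_of_lattice isWeightedHomogeneous_topComponent isWeightedHomogeneous_topComponent_one
    apply_eq_of_mem_support_topComponent eq_monomial_of_support_eq_singleton exists_apply_ne_of_not_singleton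
    topComponent_face_insert topComponent_face_self face_empty_eq)
open scoped NNReal BigOperators

/-! ### §1 The descent -/

section Descent

variable {n : ℕ}

/-- ★★ **NEWTON-DIMENSION DESCENT.**  Let some nest-free perfect matching avoid `I`, and let `g ≠ 0` be homogeneous with
`dim aff (supp g) ≤ D`.  Then for some `I' ⊇ I` with `|I'| ≤ |I| + D`, still avoided by a nest-free perfect matching, and some
monomial `c x^d` (`c ≠ 0`): `L₊(NN_n^{¬I'} · c x^d) ≤ L₊(NN_n^{¬I} · g)` — iterate the free initial forms `top_{𝟙_{≠e}}` along arcs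
`e` chosen by the cofactor. [cite: Burgisser2000, Rem. 2.7] -/
theorem descent (D : ℕ) : ∀ (I : Finset (Fin (2 * n) × Fin (2 * n))),
    (∃ M ∈ nestFreeMatchings (2 * n), ∀ i ∈ openers M, (i, M i) ∉ I) →
    ∀ (g : MvPolynomial (Fin (2 * n) × Fin (2 * n)) ℝ≥0), g ≠ 0 → ∀ N : ℕ, IsWeightedHomogeneous 1 g N →
    Module.finrank ℚ (vectorSpan ℚ ((fun u : (Fin (2 * n) × Fin (2 * n)) →₀ ℕ =>
      fun a : Fin (2 * n) × Fin (2 * n) => (u a : ℚ)) '' (g.support : Set ((Fin (2 * n) × Fin (2 * n)) →₀ ℕ)))) ≤ D →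
    ∃ I' : Finset (Fin (2 * n) × Fin (2 * n)), I ⊆ I' ∧ I'.card ≤ I.card + D ∧
      (∃ M ∈ nestFreeMatchings (2 * n), ∀ i ∈ openers M, (i, M i) ∉ I') ∧
      ∃ (d : (Fin (2 * n) × Fin (2 * n)) →₀ ℕ) (c : ℝ≥0), c ≠ 0 ∧
        complexity ((∑ M ∈ (nestFreeMatchings (2 * n)).filter (fun M => ∀ i ∈ openers M, (i, M i) ∉ I'),
          arcMonomial ℝ≥0 M) * monomial d c) ≤
        complexity ((∑ M ∈ (nestFreeMatchings (2 * n)).filter (fun M => ∀ i ∈ openers M, (i, M i) ∉ I),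
          arcMonomial ℝ≥0 M) * g) := by
  classical
  -- the conclusion when `g` is already a monomial
  have base : ∀ (D : ℕ) (I : Finset (Fin (2 * n) × Fin (2 * n))),
      (∃ M ∈ nestFreeMatchings (2 * n), ∀ i ∈ openers M, (i, M i) ∉ I) →
      ∀ (g : MvPolynomial (Fin (2 * n) × Fin (2 * n)) ℝ≥0), g ≠ 0 → (∃ d, g.support = {d}) →
      ∃ I' : Finset (Fin (2 * n) × Fin (2 * n)), I ⊆ I' ∧ I'.card ≤ I.card + D ∧
        (∃ M ∈ nestFreeMatchings (2 * n), ∀ i ∈ openers M, (i, M i) ∉ I') ∧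
        ∃ (d : (Fin (2 * n) × Fin (2 * n)) →₀ ℕ) (c : ℝ≥0), c ≠ 0 ∧
          complexity ((∑ M ∈ (nestFreeMatchings (2 * n)).filter (fun M => ∀ i ∈ openers M, (i, M i) ∉ I'),
            arcMonomial ℝ≥0 M) * monomial d c) ≤
          complexity ((∑ M ∈ (nestFreeMatchings (2 * n)).filter (fun M => ∀ i ∈ openers M, (i, M i) ∉ I),
            arcMonomial ℝ≥0 M) * g) := by
    intro D I hI g hg0 ⟨d, hd⟩
    refine ⟨I, subset_rfl, Nat.le_add_right _ _, hI, d, coeff d g, ?_, ?_⟩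
    · exact mem_support_iff.1 (by rw [hd]; exact Finset.mem_singleton_self d)
    · rw [← eq_monomial_of_support_eq_singleton hd]
  induction D with
  | zero =>
    intro I hI g hg0 N hg hD
    refine base 0 I hI g hg0 ?_
    by_contra hns
    obtain ⟨u, hu, u', hu', e, he⟩ := exists_apply_ne_of_not_singleton hg0 hns
    have hpos := finrank_vectorSpan_pos (S := (fun u : (Fin (2 * n) × Fin (2 * n)) →₀ ℕ =>
        fun a : Fin (2 * n) × Fin (2 * n) => (u a : ℚ)) '' (g.support : Set ((Fin (2 * n) × Fin (2 * n)) →₀ ℕ)))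
      (Set.mem_image_of_mem _ (Finset.mem_coe.2 hu)) (Set.mem_image_of_mem _ (Finset.mem_coe.2 hu'))
      (fun hEq => he (by have := congr_fun hEq e; exact_mod_cast this))
    omega
  | succ D ih =>
    intro I hI g hg0 N hg hD
    by_cases hns : ∃ d, g.support = {d}
    · exact base (D + 1) I hI g hg0 hns
    obtain ⟨u, hu, u', hu', e, he⟩ := exists_apply_ne_of_not_singleton hg0 hns
    -- the step in direction `𝟙_{≠ e}`
    set w : Fin (2 * n) × Fin (2 * n) → ℕ :=
      fun a => if a ∈ ({e} : Finset (Fin (2 * n) × Fin (2 * n))) then 0 else 1 with hw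
    set g' := topComponent w g with hg'
    have hg'0 : g' ≠ 0 := topComponent_ne_zero w hg0
    have hg'N : IsWeightedHomogeneous 1 g' N := isWeightedHomogeneous_topComponent hg w
    -- the Newton dimension drops
    have hD' : Module.finrank ℚ (vectorSpan ℚ ((fun u : (Fin (2 * n) × Fin (2 * n)) →₀ ℕ =>
        fun a : Fin (2 * n) × Fin (2 * n) => (u a : ℚ)) '' (g'.support : Set ((Fin (2 * n) × Fin (2 * n)) →₀ ℕ)))) ≤
        D := by
      have hlt := finrank_vectorSpan_lt_of_pinned
        (S := (fun u : (Fin (2 * n) × Fin (2 * n)) →₀ ℕ => fun a : Fin (2 * n) × Fin (2 * n) => (u a : ℚ)) ''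
          (g.support : Set ((Fin (2 * n) × Fin (2 * n)) →₀ ℕ)))
        (S' := (fun u : (Fin (2 * n) × Fin (2 * n)) →₀ ℕ => fun a : Fin (2 * n) × Fin (2 * n) => (u a : ℚ)) ''
          (g'.support : Set ((Fin (2 * n) × Fin (2 * n)) →₀ ℕ)))
        (Set.image_mono (Finset.coe_subset.2 (support_topComponent_subset w g))) e
        (by
          rintro p ⟨v, hv, rfl⟩ q ⟨v', hv', rfl⟩
          have := apply_eq_of_mem_support_topComponent hg e (Finset.mem_coe.1 hv) (Finset.mem_coe.1 hv')
          simp [this])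
        (Set.mem_image_of_mem _ (Finset.mem_coe.2 hu)) (Set.mem_image_of_mem _ (Finset.mem_coe.2 hu'))
        (by exact_mod_cast he)
      omega
    -- the face side
    have hstep : ∃ I₁ : Finset (Fin (2 * n) × Fin (2 * n)), I ⊆ I₁ ∧ I₁.card ≤ I.card + 1 ∧
        (∃ M ∈ nestFreeMatchings (2 * n), ∀ i ∈ openers M, (i, M i) ∉ I₁) ∧
        topComponent w (∑ M ∈ (nestFreeMatchings (2 * n)).filter (fun M => ∀ i ∈ openers M, (i, M i) ∉ I),
          arcMonomial ℝ≥0 M) =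
          ∑ M ∈ (nestFreeMatchings (2 * n)).filter (fun M => ∀ i ∈ openers M, (i, M i) ∉ I₁), arcMonomial ℝ≥0 M := by
      by_cases hIe : ∃ M ∈ nestFreeMatchings (2 * n), ∀ i ∈ openers M, (i, M i) ∉ insert e I
      · exact ⟨insert e I, Finset.subset_insert _ _, Finset.card_insert_le _ _, hIe, topComponent_face_insert I e hIe⟩
      · exact ⟨I, subset_rfl, Nat.le_succ _, hI, topComponent_face_self I e hI hIe⟩
    obtain ⟨I₁, hII₁, hI₁card, hI₁, htop⟩ := hstep
    have hcost : complexity ((∑ M ∈ (nestFreeMatchings (2 * n)).filter (fun M => ∀ i ∈ openers M, (i, M i) ∉ I₁),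
          arcMonomial ℝ≥0 M) * g') ≤
        complexity ((∑ M ∈ (nestFreeMatchings (2 * n)).filter (fun M => ∀ i ∈ openers M, (i, M i) ∉ I),
          arcMonomial ℝ≥0 M) * g) := by
      rw [← htop, hg', ← topComponent_mul]
      exact complexity_topComponent_le w _
    obtain ⟨I', hI₁I', hI'card, hI', d, c, hc, hle⟩ := ih I₁ hI₁ g' hg'0 N hg'N hD'
    exact ⟨I', hII₁.trans hI₁I', by omega, hI', d, c, hc, hle.trans hcost⟩

/-- ★★ **A certificate computes an arc-avoiding face with at most `dim Newt(h)` avoided arcs, times a monomial.**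
For `n ≥ 3` and every `h ≠ 0` there are an arc set `I` with `|I| ≤ dim Newt(h)` avoided by some nest-free perfect matching
and a monomial `c x^d`, `c ≠ 0`, with `L₊(NN_n^{¬I} · c x^d) ≤ L₊(NN_n · h)`. [cite: Burgisser2000, Rem. 2.7] -/
theorem exists_face_of_newtonDim (hn : 3 ≤ n) {h : MvPolynomial (Fin (2 * n) × Fin (2 * n)) ℝ≥0} (hh : h ≠ 0) :
    ∃ I : Finset (Fin (2 * n) × Fin (2 * n)),
      I.card ≤ Module.finrank ℚ (vectorSpan ℚ ((fun u : (Fin (2 * n) × Fin (2 * n)) →₀ ℕ =>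
        fun a : Fin (2 * n) × Fin (2 * n) => (u a : ℚ)) '' (h.support : Set ((Fin (2 * n) × Fin (2 * n)) →₀ ℕ)))) ∧
      (∃ M ∈ nestFreeMatchings (2 * n), ∀ i ∈ openers M, (i, M i) ∉ I) ∧
      ∃ (d : (Fin (2 * n) × Fin (2 * n)) →₀ ℕ) (c : ℝ≥0), c ≠ 0 ∧
        complexity ((∑ M ∈ (nestFreeMatchings (2 * n)).filter (fun M => ∀ i ∈ openers M, (i, M i) ∉ I),
          arcMonomial ℝ≥0 M) * monomial d c) ≤ complexity (nestFreeMatchingPoly n ℝ≥0 * h) := by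
  classical
  -- homogenise: pass to the total-degree initial form of `h` (free; `NN_n` is homogeneous)
  set g := topComponent (1 : Fin (2 * n) × Fin (2 * n) → ℕ) h with hg_def
  have hg0 : g ≠ 0 := topComponent_ne_zero _ hh
  have hgN := isWeightedHomogeneous_topComponent_one h
  have h0 : ∃ M ∈ nestFreeMatchings (2 * n), ∀ i ∈ openers M, (i, M i) ∉ (∅ : Finset (Fin (2 * n) × Fin (2 * n))) :=
    exists_nestFree_avoiding_of_card_le (k := 0) (by omega) ∅ (by simp)
  have hmono : Module.finrank ℚ (vectorSpan ℚ ((fun u : (Fin (2 * n) × Fin (2 * n)) →₀ ℕ =>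
        fun a : Fin (2 * n) × Fin (2 * n) => (u a : ℚ)) '' (g.support : Set ((Fin (2 * n) × Fin (2 * n)) →₀ ℕ)))) ≤
      Module.finrank ℚ (vectorSpan ℚ ((fun u : (Fin (2 * n) × Fin (2 * n)) →₀ ℕ =>
        fun a : Fin (2 * n) × Fin (2 * n) => (u a : ℚ)) '' (h.support : Set ((Fin (2 * n) × Fin (2 * n)) →₀ ℕ)))) :=
    Submodule.finrank_mono (vectorSpan_mono ℚ (Set.image_mono (Finset.coe_subset.2 (support_topComponent_subset _ h))))
  obtain ⟨I, -, hIcard, hI, d, c, hc, hle⟩ := descent _ ∅ h0 g hg0 _ hgN le_rfl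
  have hI0 : I.card ≤ Module.finrank ℚ (vectorSpan ℚ ((fun u : (Fin (2 * n) × Fin (2 * n)) →₀ ℕ =>
      fun a : Fin (2 * n) × Fin (2 * n) => (u a : ℚ)) '' (g.support : Set ((Fin (2 * n) × Fin (2 * n)) →₀ ℕ)))) := by
    simpa using hIcard
  refine ⟨I, hI0.trans hmono, hI, d, c, hc, hle.trans ?_⟩
  have hprod : nestFreeMatchingPoly n ℝ≥0 * g =
      topComponent (1 : Fin (2 * n) × Fin (2 * n) → ℕ) (nestFreeMatchingPoly n ℝ≥0 * h) := by
    rw [topComponent_mul, topComponent_eq_self_of_isWeightedHomogeneous (1 : Fin (2 * n) × Fin (2 * n) → ℕ)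
      (nestFreeMatchingPoly_isHomogeneous (n := n) (k := ℝ≥0))]
  rw [face_empty_eq, hprod]
  exact complexity_topComponent_le _ _

/-- ★ **… hence computes the bare face at polynomial cost**: `L₊(NN_n^{¬I}) ≤ 16 ((2n+1) (L₊(NN_n · h) + 2))²` for some arc
set `I` with `|I| ≤ dim Newt(h)` avoided by a nest-free perfect matching (divide by `c`, strip `x^d` by the
Jukna–Seiwert–Sergeev contraction). [cite: JuknaSeiwertSergeev2022, Thm 1] -/
theorem complexity_face_le_of_newtonDim (hn : 3 ≤ n) {h : MvPolynomial (Fin (2 * n) × Fin (2 * n)) ℝ≥0}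
    (hh : h ≠ 0) :
    ∃ I : Finset (Fin (2 * n) × Fin (2 * n)),
      I.card ≤ Module.finrank ℚ (vectorSpan ℚ ((fun u : (Fin (2 * n) × Fin (2 * n)) →₀ ℕ =>
        fun a : Fin (2 * n) × Fin (2 * n) => (u a : ℚ)) '' (h.support : Set ((Fin (2 * n) × Fin (2 * n)) →₀ ℕ)))) ∧
      (∃ M ∈ nestFreeMatchings (2 * n), ∀ i ∈ openers M, (i, M i) ∉ I) ∧
      complexity (∑ M ∈ (nestFreeMatchings (2 * n)).filter (fun M => ∀ i ∈ openers M, (i, M i) ∉ I),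
          arcMonomial ℝ≥0 M) ≤ 16 * ((2 * n + 1) * (complexity (nestFreeMatchingPoly n ℝ≥0 * h) + 2)) ^ 2 := by
  obtain ⟨I, hIcard, hI, d, c, hc, H⟩ := exists_face_of_newtonDim hn hh
  refine ⟨I, hIcard, hI, ?_⟩
  set F := ∑ M ∈ (nestFreeMatchings (2 * n)).filter (fun M => ∀ i ∈ openers M, (i, M i) ∉ I), arcMonomial ℝ≥0 M
    with hF
  -- divide by `c`
  have hsplit : monomial d (1 : ℝ≥0) * F = (F * monomial d c) * C c⁻¹ := by
    have hcc : C c * C c⁻¹ = (1 : MvPolynomial (Fin (2 * n) × Fin (2 * n)) ℝ≥0) := by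
      rw [← C_mul, mul_inv_cancel₀ hc, C_1]
    calc monomial d (1 : ℝ≥0) * F = (C c * C c⁻¹) * (monomial d 1 * F) := by rw [hcc, one_mul]
      _ = (F * (C c * monomial d 1)) * C c⁻¹ := by ring
      _ = (F * monomial d c) * C c⁻¹ := by rw [C_mul_monomial, mul_one]
  have H1 : complexity (monomial d (1 : ℝ≥0) * F) ≤ complexity (nestFreeMatchingPoly n ℝ≥0 * h) + 1 := by
    calc complexity (monomial d (1 : ℝ≥0) * F) = complexity ((F * monomial d c) * C c⁻¹) := by rw [hsplit]
      _ ≤ complexity (F * monomial d c) + complexity (C c⁻¹ : MvPolynomial (Fin (2 * n) × Fin (2 * n)) ℝ≥0) + 1 :=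
          complexity_mul_le_holds _ _
      _ = complexity (F * monomial d c) + 1 := by rw [complexity_C_holds, add_zero]
      _ ≤ complexity (nestFreeMatchingPoly n ℝ≥0 * h) + 1 := by gcongr
  have H2 := complexity_le_of_monomial_mul (2 * n) d F
  calc complexity F ≤ 16 * ((2 * n + 1) * (complexity (monomial d (1 : ℝ≥0) * F) + 1)) ^ 2 := H2
    _ ≤ 16 * ((2 * n + 1) * (complexity (nestFreeMatchingPoly n ℝ≥0 * h) + 1 + 1)) ^ 2 := by gcongr

end Descent

/-! ### §2 The tier: cofactors of low Newton dimension are not certificates -/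

section Tier

/-- ★★ **COFACTORS OF NEWTON DIMENSION `≤ √n − 1` ARE NOT CERTIFICATES.**  For every `c`, eventually in `n`: every `h ≠ 0`
whose support spans an affine space of dimension `D` with `(D + 1)² ≤ n` satisfies
`2^((log₂ n + c)^c) < L₊(NN_n · h) + L₊(h)`. [cite: HrubesYehudayoff2021, §6 Problem 2] [cite: JuknaSeiwertSergeev2022, Thm 1] -/
theorem newtonDim_not_certificate_qp (c : ℕ) : ∃ n₀ : ℕ, ∀ n : ℕ, n₀ ≤ n →
    ∀ h : MvPolynomial (Fin (2 * n) × Fin (2 * n)) ℝ≥0, h ≠ 0 →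
      (Module.finrank ℚ (vectorSpan ℚ ((fun u : (Fin (2 * n) × Fin (2 * n)) →₀ ℕ =>
        fun a : Fin (2 * n) × Fin (2 * n) => (u a : ℚ)) '' (h.support : Set ((Fin (2 * n) × Fin (2 * n)) →₀ ℕ))))
        + 1) ^ 2 ≤ n →
      2 ^ ((Nat.log 2 n + c) ^ c) < complexity (nestFreeMatchingPoly n ℝ≥0 * h) + complexity h := by
  obtain ⟨n₀, hn₀⟩ := sqrtArcFaces_qp_hard c
  refine ⟨max n₀ 3, fun n hn h hh hD => ?_⟩
  have hn3 : 3 ≤ n := le_trans (le_max_right _ _) hn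
  obtain ⟨I, hIcard, -, hface⟩ := complexity_face_le_of_newtonDim hn3 hh
  have hI : (I.card + 1) ^ 2 ≤ n := le_trans (Nat.pow_le_pow_left (Nat.add_le_add_right hIcard 1) 2) hD
  exact lt_of_lt_of_le (hn₀ n (le_trans (le_max_left _ _) hn) I hI _ hface) (Nat.le_add_right _ _)

/-- ★ **… after any free initial form.**  If `w` is a direction in which `NN_n` is its own initial form (e.g. a vertex
potential `w(i,j) = λ_i + λ_j`, or `𝟙`), then `h` may be replaced by `top_w h`: for every `c`, eventually in `n`, every `h ≠ 0`
with `(dim Newt(top_w h) + 1)² ≤ n` satisfies `2^((log₂ n + c)^c) < L₊(NN_n · h) + L₊(h)` (so the tier may be applied to the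
torus-homogeneous initial forms of the residual). [cite: HrubesYehudayoff2021, §6 Problem 2] [cite: Burgisser2000, Rem. 2.7] -/
theorem newtonDim_top_not_certificate_qp (c : ℕ) : ∃ n₀ : ℕ, ∀ n : ℕ, n₀ ≤ n →
    ∀ (w : Fin (2 * n) × Fin (2 * n) → ℕ),
      topComponent w (nestFreeMatchingPoly n ℝ≥0) = nestFreeMatchingPoly n ℝ≥0 →
    ∀ h : MvPolynomial (Fin (2 * n) × Fin (2 * n)) ℝ≥0, h ≠ 0 →
      (Module.finrank ℚ (vectorSpan ℚ ((fun u : (Fin (2 * n) × Fin (2 * n)) →₀ ℕ =>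
        fun a : Fin (2 * n) × Fin (2 * n) => (u a : ℚ)) ''
          ((topComponent w h).support : Set ((Fin (2 * n) × Fin (2 * n)) →₀ ℕ)))) + 1) ^ 2 ≤ n →
      2 ^ ((Nat.log 2 n + c) ^ c) < complexity (nestFreeMatchingPoly n ℝ≥0 * h) + complexity h := by
  obtain ⟨n₀, hn₀⟩ := newtonDim_not_certificate_qp c
  refine ⟨n₀, fun n hn w hw h hh hD => ?_⟩
  have H := hn₀ n hn (topComponent w h) (topComponent_ne_zero w hh) hD
  have hprod : nestFreeMatchingPoly n ℝ≥0 * topComponent w h = topComponent w (nestFreeMatchingPoly n ℝ≥0 * h) := by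
    rw [topComponent_mul, hw]
  have h1 : complexity (nestFreeMatchingPoly n ℝ≥0 * topComponent w h) ≤
      complexity (nestFreeMatchingPoly n ℝ≥0 * h) := by
    rw [hprod]
    exact complexity_topComponent_le w _
  have h2 : complexity (topComponent w h) ≤ complexity h := complexity_topComponent_le w h
  omega

/-- ★ **FEW-MONOMIAL COFACTORS ARE NOT CERTIFICATES**: for every `c`, eventually in `n`, every `h ≠ 0` with `|supp h|² ≤ n`
(any degrees, any supports) satisfies `2^((log₂ n + c)^c) < L₊(NN_n · h) + L₊(h)`.
[cite: HrubesYehudayoff2021, §6 Problem 2] -/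
theorem fewMonomials_not_certificate_qp (c : ℕ) : ∃ n₀ : ℕ, ∀ n : ℕ, n₀ ≤ n →
    ∀ h : MvPolynomial (Fin (2 * n) × Fin (2 * n)) ℝ≥0, h ≠ 0 → h.support.card ^ 2 ≤ n →
      2 ^ ((Nat.log 2 n + c) ^ c) < complexity (nestFreeMatchingPoly n ℝ≥0 * h) + complexity h := by
  classical
  obtain ⟨n₀, hn₀⟩ := newtonDim_not_certificate_qp c
  refine ⟨n₀, fun n hn h hh hcard => hn₀ n hn h hh (le_trans (Nat.pow_le_pow_left ?_ 2) hcard)⟩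
  have hpos : 0 < h.support.card := Finset.card_pos.2 (support_nonempty.2 hh)
  have := finrank_vectorSpan_image_le_card_pred h.support (support_nonempty.2 hh)
  omega

/-- ★ **LOW-RANK COFACTORS ARE NOT CERTIFICATES**: for every `c`, eventually in `n`, every `h ≠ 0` all of whose monomials lie
on a translated lattice `u₀ + ℕ v₁ + ⋯ + ℕ v_D` with `(D + 1)² ≤ n` — i.e. `h = x^{u₀} · G(x^{v₁}, …, x^{v_D})` for some
polynomial `G` in `D` arbitrary monomials, e.g. every positive power sum or product of power sums of `≤ √n − 1` monomials —
satisfies `2^((log₂ n + c)^c) < L₊(NN_n · h) + L₊(h)`. [cite: HrubesYehudayoff2021, §6 Problem 2] -/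
theorem lowRank_not_certificate_qp (c : ℕ) : ∃ n₀ : ℕ, ∀ n : ℕ, n₀ ≤ n →
    ∀ (D : ℕ) (u₀ : (Fin (2 * n) × Fin (2 * n)) →₀ ℕ) (v : Fin D → ((Fin (2 * n) × Fin (2 * n)) →₀ ℕ))
      (h : MvPolynomial (Fin (2 * n) × Fin (2 * n)) ℝ≥0), h ≠ 0 →
      (∀ u ∈ h.support, ∃ a : Fin D → ℕ, u = u₀ + ∑ k, a k • v k) → (D + 1) ^ 2 ≤ n →
      2 ^ ((Nat.log 2 n + c) ^ c) < complexity (nestFreeMatchingPoly n ℝ≥0 * h) + complexity h := by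
  obtain ⟨n₀, hn₀⟩ := newtonDim_not_certificate_qp c
  refine ⟨n₀, fun n hn D u₀ v h hh hlat hD => hn₀ n hn h hh (le_trans (Nat.pow_le_pow_left ?_ 2) hD)⟩
  exact Nat.add_le_add_right (finrank_vectorSpan_image_le_of_lattice u₀ v _ fun u hu => hlat u hu) 1

/-- ★ **BY NAME: `NNDivisionHard` ⟺ its HIGH-NEWTON-DIMENSION tier** — the crux is equivalent to the same inequality for
the cofactors whose Newton polytope has dimension `D` with `n < (D + 1)²`. [cite: HrubesYehudayoff2021, §6 Problem 2] -/
theorem nnDivisionHard_iff_highNewtonDimTier :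
    Summit.ValiantsHypothesis.ValiantsHypothesis.Theses.FifoMatching.NNDivisionHard ↔
    ∀ c : ℕ, ∃ n₀ : ℕ, ∀ n ≥ n₀, ∀ h : MvPolynomial (Fin (2 * n) × Fin (2 * n)) ℝ≥0, h ≠ 0 →
      n < (Module.finrank ℚ (vectorSpan ℚ ((fun u : (Fin (2 * n) × Fin (2 * n)) →₀ ℕ =>
        fun a : Fin (2 * n) × Fin (2 * n) => (u a : ℚ)) '' (h.support : Set ((Fin (2 * n) × Fin (2 * n)) →₀ ℕ))))
        + 1) ^ 2 →
      2 ^ ((Nat.log 2 n + c) ^ c) < complexity (nestFreeMatchingPoly n ℝ≥0 * h) + complexity h := by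
  constructor
  · intro hN c
    obtain ⟨n₀, hn₀⟩ := hN c
    exact ⟨n₀, fun n hn h hh _ => hn₀ n hn h hh⟩
  · intro H c
    obtain ⟨n₀, hn₀⟩ := H c
    obtain ⟨n₁, hn₁⟩ := newtonDim_not_certificate_qp c
    refine ⟨max n₀ n₁, fun n hn h hh => ?_⟩
    by_cases hD : (Module.finrank ℚ (vectorSpan ℚ ((fun u : (Fin (2 * n) × Fin (2 * n)) →₀ ℕ =>
        fun a : Fin (2 * n) × Fin (2 * n) => (u a : ℚ)) '' (h.support : Set ((Fin (2 * n) × Fin (2 * n)) →₀ ℕ))))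
        + 1) ^ 2 ≤ n
    · exact hn₁ n (le_trans (le_max_right _ _) hn) h hh hD
    · exact hn₀ n (le_trans (le_max_left _ _) hn) h hh (not_le.1 hD)

end Tier

end Summit.ValiantsHypothesis.ValiantsHypothesis.Theorems.FifoMatching.NNDivisionHard.NewtonDimension

end
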